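import Literature.NumberTheory.Automorphic.IrreducibleClassesComap
import Literature.NumberTheory.Automorphic.HeckeEigencharacterPackage
import HarnessLib

/-!
# Sphericity and admissibility of a class are transported along `IrrClass.comap e` with the level `e⁻¹(K)`
# (Cartier §IV.1; Bushnell–Henniart §1.1)

Topic `NumberTheory/Automorphic`.  PROOF FILE (theorems only; no definition, no named fact, no instance, no notation, no `sorry`).
For an isomorphism of topological groups `e : G′ ≃ₜ* G` the pull-back ★ `IrrClass.comap e : Irr(G) → Irr(G′)` (`⟦r⟧ ↦ ⟦r ∘ e⟧`,
★ `IrreducibleClassesComap`) matches `K′`-fixed vectors of `r ∘ e` with `e(K′)`-fixed vectors of `r` (★ `Representation.fixedPoints_comp`),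
so:

* `Representation.isSpherical_comp_iff` — `(σ ∘ f)` is `K`-spherical iff `σ` is `f(K)`-spherical (any `f : G →* H`);
* `IrrClass.isSpherical_comap_iff` ∕ `isSpherical_comap_iff_of_map_eq` ∕ `isSpherical_comap_iff_of_forall_mem_iff` ∕ `isSpherical_comap_comap_iff` ∕
  `isSpherical_comap_symm_map_iff` — **`(comap e c).IsSpherical K′ ↔ c.IsSpherical (e(K′))`**, in particular for a LEVEL-MATCHING `e` (`e(K′) = K`,
  or `e g′ ∈ K ↔ g′ ∈ K′` as in ★ `localFormCongr_mem_localIntegralLevel_iff` ∕ ★ `exists_conj_levelMatching_of_smul_eq` for an integral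
  similitude) `(comap e c).IsSpherical K′ ↔ c.IsSpherical K`;
* `IrrClass.IsAdmissible.comap` ∕ `isAdmissible_comap_iff` — admissibility is invariant (★ `Representation.IsAdmissible.comp_mulEquiv`).

Use (Hodge-CM programme, rung 4, PLAN.F0P3g4 §24 Z7 (β), transport step (t-i)): D6's non-split packet member is `IrrClass.comap e x` for a
constituent `x` of `i_G(χ_ξ)` on the quasi-split carrier and a form congruence `e` (★ `OneDimAutRepH.IsXiLocalFamily`, ★ `cmNonsplitPacket`);
with a level-matching `e` the `K_v`-sphericity of the member is read off from that of `x`.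

## References
* P. Cartier, *Representations of 𝔭-adic groups: a survey*, PSPM 33.1 (1979), §IV.1 [CartierCorvallis1979].
* C. Bushnell, G. Henniart, *The local Langlands conjecture for GL(2)* (2006), §1.1 [BushnellHenniart2006].
-/

set_option autoImplicit false

universe u

namespace Representation

variable {k G H V : Type*} [CommRing k] [Group G] [Group H] [AddCommGroup V] [Module k V]

/-- **`(σ ∘ f)^K = σ^{f(K)}`, read on `IsSpherical`**: `σ ∘ f` is `K`-spherical iff `σ` is `f(K)`-spherical (★ `fixedPoints_comp`).
[cite: CartierCorvallis1979, §IV.1] -/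
theorem isSpherical_comp_iff (σ : Representation k H V) (f : G →* H) (K : Subgroup G) :
    IsSpherical (σ.comp f) K ↔ σ.IsSpherical (K.map f) := by
  rw [isSpherical_iff, isSpherical_iff, fixedPoints_comp]

end Representation

namespace Literature.NumberTheory.Automorphic

namespace IrrClass

variable {G G' : Type u} [Group G] [TopologicalSpace G] [Group G'] [TopologicalSpace G']

/-- **`⟦r ∘ e⟧` is `K′`-spherical iff `⟦r⟧` is `e(K′)`-spherical.** [cite: CartierCorvallis1979, §IV.1] [cite: BushnellHenniart2006, §1.1] -/
theorem isSpherical_comap_iff (e : G' ≃ₜ* G) (c : IrrClass G) (K' : Subgroup G') :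
    (comap e c).IsSpherical K' ↔ c.IsSpherical (K'.map (e : G' →* G)) := by
  obtain ⟨r, rfl⟩ := mk_surjective c
  rw [comap_mk, isSpherical_mk, isSpherical_mk, SmoothIrrep.comap_ρ]
  exact Representation.isSpherical_comp_iff r.ρ _ K'

/-- **Level-matching transport**: if `e(K′) = K` then `⟦r ∘ e⟧` is `K′`-spherical iff `⟦r⟧` is `K`-spherical.
[cite: CartierCorvallis1979, §IV.1] [cite: BushnellHenniart2006, §1.1] -/
theorem isSpherical_comap_iff_of_map_eq (e : G' ≃ₜ* G) (c : IrrClass G) {K' : Subgroup G'} {K : Subgroup G}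
    (hK : K'.map (e : G' →* G) = K) : (comap e c).IsSpherical K' ↔ c.IsSpherical K := by
  rw [isSpherical_comap_iff, hK]

/-- `⟦r ∘ e⟧` is `e⁻¹(K)`-spherical iff `⟦r⟧` is `K`-spherical. [cite: CartierCorvallis1979, §IV.1] [cite: BushnellHenniart2006, §1.1] -/
theorem isSpherical_comap_comap_iff (e : G' ≃ₜ* G) (c : IrrClass G) (K : Subgroup G) :
    (comap e c).IsSpherical (K.comap (e : G' →* G)) ↔ c.IsSpherical K :=
  isSpherical_comap_iff_of_map_eq e c (Subgroup.map_comap_eq_self_of_surjective e.surjective K)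

/-- **Level matching in the `↔` currency** of ★ `localFormCongr_mem_localIntegralLevel_iff` ∕ ★ `exists_conj_levelMatching_of_smul_eq`
(`e g′ ∈ K ↔ g′ ∈ K′` for all `g′`): then `e(K′) = K`, so `⟦r ∘ e⟧` is `K′`-spherical iff `⟦r⟧` is `K`-spherical.
[cite: CartierCorvallis1979, §IV.1] [cite: BushnellHenniart2006, §1.1] -/
theorem isSpherical_comap_iff_of_forall_mem_iff (e : G' ≃ₜ* G) (c : IrrClass G) {K' : Subgroup G'} {K : Subgroup G}
    (hK : ∀ g' : G', e g' ∈ K ↔ g' ∈ K') : (comap e c).IsSpherical K' ↔ c.IsSpherical K := by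
  refine isSpherical_comap_iff_of_map_eq e c (Subgroup.ext fun g => ⟨?_, fun hg => ?_⟩)
  · rintro ⟨g', hg', rfl⟩
    exact (hK g').2 hg'
  · refine ⟨e.symm g, (hK _).1 ?_, e.apply_symm_apply g⟩
    rw [ContinuousMulEquiv.apply_symm_apply]
    exact hg

/-- The same along `e⁻¹`: `⟦r ∘ e⁻¹⟧` is `e(K′)`-spherical iff `⟦r⟧` is `K′`-spherical. [cite: CartierCorvallis1979, §IV.1] -/
theorem isSpherical_comap_symm_map_iff (e : G' ≃ₜ* G) (c : IrrClass G') (K' : Subgroup G') :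
    (comap e.symm c).IsSpherical (K'.map (e : G' →* G)) ↔ c.IsSpherical K' := by
  refine isSpherical_comap_iff_of_map_eq e.symm c ?_
  rw [Subgroup.map_map]
  convert Subgroup.map_id K'
  ext g
  exact e.symm_apply_apply g

/-- **Admissibility is transported along `comap e`** (★ `Representation.IsAdmissible.comp_mulEquiv`: `e` is continuous and open).
[cite: BushnellHenniart2006, §1.1] -/
theorem IsAdmissible.comap (e : G' ≃ₜ* G) {c : IrrClass G} (h : c.IsAdmissible) : (IrrClass.comap e c).IsAdmissible := by
  obtain ⟨r, rfl⟩ := mk_surjective c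
  rw [comap_mk, isAdmissible_mk, SmoothIrrep.comap_ρ]
  exact Representation.IsAdmissible.comp_mulEquiv ((isAdmissible_mk r).1 h) e.toMulEquiv e.continuous e.toHomeomorph.isOpenMap

/-- `⟦r ∘ e⟧` is admissible iff `⟦r⟧` is. [cite: BushnellHenniart2006, §1.1] -/
theorem isAdmissible_comap_iff (e : G' ≃ₜ* G) (c : IrrClass G) : (IrrClass.comap e c).IsAdmissible ↔ c.IsAdmissible :=
  ⟨fun h => by simpa only [comap_symm_comap] using h.comap e.symm, fun h => h.comap e⟩

end IrrClass

end Literature.NumberTheory.Automorphic
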